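import Summits.CriticalPhenomena.SAWScalingLimit.Theorems.SAWTotalPositivityCriticalBubbleBoundJoinAssembly
import Summits.CriticalPhenomena.SAWScalingLimit.Theorems.SAWTotalPositivityCriticalBubbleBoundJoinReflect

/-!
# Re-rooting the Madras join into the class model
(line `docking-census-joining`, stub `joinPoly_reroot`)

Crux `stmt-CriticalPhenomena-7117`
(`Summit.CriticalPhenomena.SAWScalingLimit.Theses.SAWTotalPositivity.CriticalBubbleBound`), line
`docking-census-joining`, JOIN-MASS programme (lead c6, wave 3), registered stub `joinPoly_reroot`
(objects `lexRooted`, `IsJoinPlaq`, `flipH`, `IsGlobalJoin`, `gjoins` of `…JoinDefs`; `vxs`, `IsV`,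
`trE`, `lexMinV`, `rerootWalk`, `rerootSite`, `joinPoly`, `joinCorner`, `offsets` of `…JoinSurgeryDefs`;
`verts`, `pedges`, `rootEdge` of `…DockingDefs`; the join assembly `joinPoly_spec` of `…JoinAssembly`).

**Statement.** For an admissible arrow (`χ₁ ∈ lexRooted j`, `χ₂ ∈ lexRooted m`, `j, m ≥ 3`,
`k ∈ offsets j m χ₁ χ₂`) with Madras join `J = joinPoly j m χ₁ χ₂ k`, junction corner
`q = joinCorner j m χ₁ χ₂ k`, `n = j + m + 17` and `v` the lowest-then-leftmost vertex of `J`: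
`rerootWalk J n ∈ lexRooted n`, `pedges n (rerootWalk J n) = J - v` and `q - v ∈ gjoins n (rerootWalk J n)`.

**Proof.** By `joinPoly_spec`, `J` is a polygon with `n + 1` edges, `q` is a join plaquette of `J`, and
the flip `flipH J q = τ̃ ∪ σ̂` splits `J` into vertex-disjoint polygons with `σ̂` strictly above row `0`,
`e₀ ∈ V(τ̃)` and some vertex of `σ̂` two columns right of all of `V(τ̃)`. The abstract re-rooting
`reroot_of_split` then does the rest:
* the lex-minimal vertex `v` of a polygon has its EAST edge `{v, v + e₀}` (corner lemma: its two
  polygon edges point in distinct lattice directions and `v - e₀`, `v - e₁` are not vertices);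
* `C = J - v` is a polygon (translation is an injective graph endomorphism, `isPolygon_image_of_hom`)
  with `n + 1` edges through the root edge `{0, e₀}`; opening it there (`Docking.exists_sawFun_pedges_eq`)
  gives `χ ∈ sawFun 2 n e₀` with `pedges n χ = C`, lex-rooted by the minimality of `v` — this is the
  existence behind `rerootWalk`;
* globalness of `q - v`: everything translates by `-v` (`flipH`, `IsJoinPlaq`, vertex sets, polygons);
  the root `0 = v - v` lies on `τ̃ - v` because `v ∈ V(σ̂)` would force `1 ≤ v 1 ≤ e₀ 1 = 0`; every
  rightmost vertex of `χ` lies on `σ̂ - v` because a `τ̃`-vertex is beaten by two columns by a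
  `σ̂`-vertex, which is itself a vertex of `χ` after translation.

Sources: A. Hammond, *An upper bound on the number of self-avoiding polygons via joining*, Ann.
Probab. 46 (2018) = arXiv:1808.09032, Definition 4.4, Lemma 4.11; N. Madras, G. Slade,
*The Self-Avoiding Walk* (1993), Definition 3.2.1–3.2.2. Elementary combinatorics ([folklore]).
-/

noncomputable section

open Literature.Probability.LatticeModels
open Literature.Probability.RandomPlanarGeometry Literature.Probability.RandomPlanarGeometry.SAW
open scoped BigOperators
open Summit.CriticalPhenomena.SAWScalingLimit.Theorems.CriticalBubbleBound.Negative (e₀)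
open Summit.CriticalPhenomena.SAWScalingLimit.Theorems.CriticalBubbleBound.Docking

namespace Summit.CriticalPhenomena.SAWScalingLimit.Theorems.CriticalBubbleBound.Join

/-! ## Translates of edge sets -/

/-- Translation of edges is injective. [folklore] -/
private theorem translate_edges_injective (u : Site 2) :
    Function.Injective (Sym2.map fun p : Site 2 => p + u) :=
  Sym2.map.injective (add_left_injective u)

/-- Membership of a translated edge in a translate. [folklore] -/
private theorem map_mem_translate_iff {u : Site 2} {E : Finset (Sym2 (Site 2))} {e : Sym2 (Site 2)} :
    Sym2.map (fun p : Site 2 => p + u) e ∈ trE u E ↔ e ∈ E := by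
  unfold trE
  exact (translate_edges_injective u).mem_finset_image

/-- Membership of a translated edge in a translate, for explicit pairs. [folklore] -/
private theorem mk_add_mem_translate_iff {u a b : Site 2} {E : Finset (Sym2 (Site 2))} :
    s(a + u, b + u) ∈ trE u E ↔ s(a, b) ∈ E := by
  have h := map_mem_translate_iff (u := u) (E := E) (e := s(a, b))
  rwa [Sym2.map_mk] at h

/-- The vertices of a translate are the translated vertices. [folklore] -/
private theorem isV_translate_iff {u x : Site 2} {E : Finset (Sym2 (Site 2))} : IsV (trE u E) x ↔ IsV E (x - u) := by
  constructor
  · rintro ⟨e, he, hx⟩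
    obtain ⟨e', he', rfl⟩ := mem_trE.1 he
    obtain ⟨y, hy, hyx⟩ := Sym2.mem_map.1 hx
    refine ⟨e', he', ?_⟩
    rw [← hyx, add_sub_cancel_right]
    exact hy
  · rintro ⟨e, he, hx⟩
    exact ⟨_, map_mem_translate_iff.2 he, Sym2.mem_map.2 ⟨x - u, hx, sub_add_cancel x u⟩⟩

/-- A translate of a polygon is a polygon. [folklore] -/
private theorem isPolygon_translate (u : Site 2) {E : Finset (Sym2 (Site 2))} (hE : IsPolygon (zdGraph 2) E) :
    IsPolygon (zdGraph 2) (trE u E) :=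
  isPolygon_image_of_hom (f := ⟨fun p => p + u, fun {x y} h => (Zd.zdGraph_adj_add_right x y u).2 h⟩)
    (add_left_injective u) hE

/-- Translation preserves the number of edges. [folklore] -/
private theorem card_translate (u : Site 2) (E : Finset (Sym2 (Site 2))) : (trE u E).card = E.card :=
  Finset.card_image_of_injective _ (translate_edges_injective u)

/-- Translation commutes with unions. [folklore] -/
private theorem translate_union (u : Site 2) (A B : Finset (Sym2 (Site 2))) : trE u (A ∪ B) = trE u A ∪ trE u B :=
  Finset.image_union _ _

/-- The un-joining flip commutes with translations. [folklore] -/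
private theorem flipH_translate (u q : Site 2) (E : Finset (Sym2 (Site 2))) :
    flipH (trE u E) (q + u) = trE u (flipH E q) := by
  have h1 : q + u + e₁ = q + e₁ + u := by abel
  have h2 : q + u + e₀ = q + e₀ + u := by abel
  have h3 : q + e₀ + u + e₁ = q + e₀ + e₁ + u := by abel
  unfold flipH trE
  rw [Finset.image_insert, Finset.image_insert, Finset.image_erase (translate_edges_injective u),
    Finset.image_erase (translate_edges_injective u)]
  simp only [Sym2.map_mk]
  rw [h1, h2, h3]

/-- Join plaquettes translate. [folklore] -/
private theorem isJoinPlaq_translate {u q : Site 2} {E : Finset (Sym2 (Site 2))} (h : IsJoinPlaq E q) :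
    IsJoinPlaq (trE u E) (q + u) := by
  have h1 : q + u + e₁ = q + e₁ + u := by abel
  have h2 : q + u + e₀ = q + e₀ + u := by abel
  have h3 : q + e₀ + u + e₁ = q + e₀ + e₁ + u := by abel
  obtain ⟨ha, hb, hc, hd⟩ := h
  unfold IsJoinPlaq
  rw [h1, h2, h3, mk_add_mem_translate_iff, mk_add_mem_translate_iff, mk_add_mem_translate_iff, mk_add_mem_translate_iff]
  exact ⟨ha, hb, hc, hd⟩

/-- The vertices of a union. [folklore] -/
private theorem isV_union_iff {A B : Finset (Sym2 (Site 2))} {x : Site 2} : IsV (A ∪ B) x ↔ IsV A x ∨ IsV B x := by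
  simp only [IsV, Finset.mem_union, or_and_right, exists_or]

/-- The flip at a join plaquette does not change the vertex set (the four corners lie on the
horizontal sides before and on the vertical sides after). [folklore] -/
private theorem isV_flipH_iff_of_isJoinPlaq {E : Finset (Sym2 (Site 2))} {q x : Site 2} (h : IsJoinPlaq E q) :
    IsV (flipH E q) x ↔ IsV E x := by
  constructor
  · rintro ⟨e, he, hx⟩
    simp only [flipH, Finset.mem_insert, Finset.mem_erase] at he
    rcases he with rfl | rfl | ⟨-, -, he⟩
    · rcases Sym2.mem_iff.1 hx with rfl | rfl
      · exact ⟨_, h.1, Sym2.mem_mk_left _ _⟩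
      · exact ⟨_, h.2.1, Sym2.mem_mk_left _ _⟩
    · rcases Sym2.mem_iff.1 hx with rfl | rfl
      · exact ⟨_, h.1, Sym2.mem_mk_right _ _⟩
      · exact ⟨_, h.2.1, Sym2.mem_mk_right _ _⟩
    · exact ⟨e, he, hx⟩
  · rintro ⟨e, he, hx⟩
    have hl : s(q, q + e₁) ∈ flipH E q := Finset.mem_insert_self _ _
    have hr : s(q + e₀, q + e₀ + e₁) ∈ flipH E q :=
      Finset.mem_insert_of_mem (Finset.mem_insert_self _ _)
    by_cases h1 : e = s(q, q + e₀)
    · subst h1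
      rcases Sym2.mem_iff.1 hx with rfl | rfl
      · exact ⟨_, hl, Sym2.mem_mk_left _ _⟩
      · exact ⟨_, hr, Sym2.mem_mk_left _ _⟩
    by_cases h2 : e = s(q + e₁, q + e₀ + e₁)
    · subst h2
      rcases Sym2.mem_iff.1 hx with rfl | rfl
      · exact ⟨_, hl, Sym2.mem_mk_right _ _⟩
      · exact ⟨_, hr, Sym2.mem_mk_right _ _⟩
    · refine ⟨e, ?_, hx⟩
      simp only [flipH, Finset.mem_insert, Finset.mem_erase]
      exact Or.inr (Or.inr ⟨h2, h1, he⟩)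

/-! ## The lowest-then-leftmost vertex of a polygon has its east edge -/

/-- An edge of a polygon of `ℤ²` is a lattice edge. [folklore] -/
private theorem polygon_adj_of_mem {E : Finset (Sym2 (Site 2))} (hE : IsPolygon (zdGraph 2) E)
    {a b : Site 2} (h : s(a, b) ∈ E) : (zdGraph 2).Adj a b := by
  -- adapted from the private helper of …JoinCaseB1C1
  obtain ⟨u, c, -, rfl⟩ := hE
  exact c.adj_of_mem_edges (List.mem_toFinset.1 h)

/-- A vertex `v` of a polygon lying on the polygon edge `{v, p}` lies on a SECOND polygon edge
`{v, r}`, `r ≠ p` (open the polygon at `{v, p}` and take the first step of the path). [folklore] -/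
private theorem polygon_exists_snd_edge {E : Finset (Sym2 (Site 2))} (hE : IsPolygon (zdGraph 2) E)
    {v p : Site 2} (h : s(v, p) ∈ E) : ∃ r, r ≠ p ∧ s(v, r) ∈ E := by
  -- adapted from the private helper of …JoinCaseB1C1
  obtain ⟨P, -, hPe, hvp, -, -⟩ := hE.exists_isPath_erase h
  cases P with
  | nil => exact absurd rfl (polygon_adj_of_mem hE h).ne
  | cons hadj P' =>
    rename_i r
    have hvr : s(v, r) ∈ (SimpleGraph.Walk.cons hadj P').edges := by
      rw [SimpleGraph.Walk.edges_cons]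
      exact List.mem_cons_self
    refine ⟨r, fun hrp => hvp (by subst hrp; exact hvr), ?_⟩
    rw [← List.mem_toFinset, hPe] at hvr
    exact (Finset.mem_erase.1 hvr).2

/-- **Corner lemma.** A vertex `v` of a polygon of `ℤ²` such that neither `v - e₀` nor `v - e₁` is a
vertex has its east edge `{v, v + e₀}` in the polygon (its two polygon edges point in two distinct
lattice directions, and only east and north are available). [folklore] -/
private theorem mk_add_e₀_mem_of_lexMin_corner {E : Finset (Sym2 (Site 2))} (hE : IsPolygon (zdGraph 2) E)
    {v : Site 2} (hv : IsV E v) (h₀ : ¬ IsV E (v - e₀)) (h₁ : ¬ IsV E (v - e₁)) :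
    s(v, v + e₀) ∈ E := by
  by_contra hcon
  have key : ∀ x, s(v, x) ∈ E → x = v + e₁ := by
    intro x hxE
    rcases adj_cases (polygon_adj_of_mem hE hxE) with rfl | rfl | rfl | rfl
    · exact (hcon hxE).elim
    · exact (h₀ ⟨_, hxE, Sym2.mem_mk_right _ _⟩).elim
    · rfl
    · exact (h₁ ⟨_, hxE, Sym2.mem_mk_right _ _⟩).elim
  obtain ⟨e, he, hve⟩ := hv
  rw [← Sym2.other_spec hve] at he
  obtain ⟨r, hrp, hrE⟩ := polygon_exists_snd_edge hE he
  exact hrp ((key r hrE).trans (key _ he).symm)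

/-- `LexPos (x - v)` from the lexicographic comparison `v ≤ x`. [folklore] -/
private theorem lexPos_sub_of_lexLE {v x : Site 2} (h : v 1 < x 1 ∨ (v 1 = x 1 ∧ v 0 ≤ x 0)) : LexPos (x - v) := by
  unfold LexPos
  simp only [Pi.sub_apply]
  rcases h with h | ⟨h, h'⟩
  · exact Or.inl (by omega)
  · exact Or.inr ⟨by omega, by omega⟩

/-! ## Re-rooting a join: the abstract statement -/

/-- **Re-rooting (abstract form).** Let `J` be a polygon with `n + 1` edges and a join plaquette at `q`
whose flip splits `J` into vertex-disjoint polygons `T ∪ S` with `S` strictly above row `0`, `e₀` a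
vertex of `T`, and some vertex of `S` at least two columns right of every vertex of `T`. Then the
translate of `J` by minus its lowest-then-leftmost vertex `v` is the rooted polygon of a lex-rooted
walk (`rerootWalk J n`), and `q - v` is a GLOBAL join plaquette of it. [cite: Hammond2015SAPJoining, Definition 4.4] -/
theorem reroot_of_split {J T S : Finset (Sym2 (Site 2))} {q : Site 2} {n : ℕ}
    (hJ : IsPolygon (zdGraph 2) J) (hJc : J.card = n + 1) (hplaq : IsJoinPlaq J q)
    (hT : IsPolygon (zdGraph 2) T) (hS : IsPolygon (zdGraph 2) S)
    (hdisj : ∀ x : Site 2, IsV T x → IsV S x → False) (hflip : flipH J q = T ∪ S)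
    (hSrow : ∀ x : Site 2, IsV S x → 1 ≤ x 1) (he₀T : IsV T e₀)
    (hw : ∃ w : Site 2, IsV S w ∧ ∀ x : Site 2, IsV T x → x 0 + 2 ≤ w 0) :
    rerootWalk J n ∈ lexRooted n ∧ pedges n (rerootWalk J n) = trE (-lexMinV (vxs J)) J ∧
      rerootSite J q ∈ gjoins n (rerootWalk J n) := by
  classical
  obtain ⟨w, hwS, hwT⟩ := hw
  have hlo : s(q, q + e₀) ∈ J := hplaq.1
  -- vertices of `J` are those of `T ∪ S`
  have hVJ : ∀ x, IsV J x ↔ IsV T x ∨ IsV S x := fun x => by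
    rw [← isV_flipH_iff_of_isJoinPlaq hplaq, hflip, isV_union_iff]
  -- the lowest-then-leftmost vertex `v`
  have hne : (vxs J).Nonempty := ⟨q, mem_vxs.2 ⟨_, hlo, Sym2.mem_mk_left _ _⟩⟩
  obtain ⟨v, hv⟩ : ∃ v, lexMinV (vxs J) = v := ⟨_, rfl⟩
  obtain ⟨hvJ, hvmin⟩ := lexMinV_spec hne
  rw [hv, mem_vxs] at hvJ
  have hvmin' : ∀ x, IsV J x → v 1 < x 1 ∨ (v 1 = x 1 ∧ v 0 ≤ x 0) := fun x hx => by
    have h := hvmin x (mem_vxs.2 hx)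
    rwa [hv] at h
  -- its east edge
  have hve : s(v, v + e₀) ∈ J := by
    refine mk_add_e₀_mem_of_lexMin_corner hJ hvJ (fun h => ?_) (fun h => ?_)
    · rcases hvmin' _ h with h1 | ⟨-, h1⟩
      · simp only [Pi.sub_apply, e₀_e₁_apply.2.1] at h1
        omega
      · simp only [Pi.sub_apply, e₀_e₁_apply.1] at h1
        omega
    · rcases hvmin' _ h with h1 | ⟨h1, -⟩
      · simp only [Pi.sub_apply, e₀_e₁_apply.2.2.2] at h1
        omega
      · simp only [Pi.sub_apply, e₀_e₁_apply.2.2.2] at h1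
        omega
  -- the translate `C = J - v` is a polygon through the root edge with `n + 1` edges
  have hCpoly : IsPolygon (zdGraph 2) (trE (-v) J) := isPolygon_translate (-v) hJ
  have hCcard : (trE (-v) J).card = n + 1 := by rw [card_translate, hJc]
  have hroot : rootEdge ∈ trE (-v) J := by
    have h := (mk_add_mem_translate_iff (u := -v)).2 hve
    have e1 : v + -v = (0 : Site 2) := by abel
    have e2 : v + e₀ + -v = e₀ := by abel
    rwa [e1, e2] at h
  -- open it at the root: a lex-rooted walk
  have hex' : ∃ χ : ℕ → Site 2, χ ∈ lexRooted n ∧ pedges n χ = trE (-v) J := by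
    obtain ⟨χ, hχ, hχe⟩ := exists_sawFun_pedges_eq _ n hCpoly hroot hCcard
    refine ⟨χ, mem_lexRooted.2 ⟨hχ, fun i hi => ?_⟩, hχe⟩
    have h1 : IsV (trE (-v) J) (χ i) := hχe ▸ exists_mem_pedges_iff.2 (apply_mem_verts χ hi)
    rw [isV_translate_iff, sub_neg_eq_add] at h1
    have h2 := lexPos_sub_of_lexLE (hvmin' _ h1)
    rwa [add_sub_cancel_right] at h2
  have hex : ∃ χ : ℕ → Site 2, χ ∈ lexRooted n ∧ pedges n χ = trE (-lexMinV (vxs J)) J := by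
    rw [hv]; exact hex'
  have hrw : rerootWalk J n = Classical.choose hex := by rw [rerootWalk, dif_pos hex]
  have hspec : rerootWalk J n ∈ lexRooted n ∧ pedges n (rerootWalk J n) = trE (-v) J := by
    rw [hrw, ← hv]; exact Classical.choose_spec hex
  rw [rerootSite, hv]
  obtain ⟨hχL, hχe⟩ := hspec
  refine ⟨hχL, hχe, ?_⟩
  generalize rerootWalk J n = χ at hχL hχe ⊢
  -- vertices of `χ` are the vertices of `J` translated by `-v`
  have hVχ : ∀ x, x ∈ verts n χ ↔ IsV J (x + v) := fun x => by
    rw [← exists_mem_pedges_iff, hχe]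
    exact isV_translate_iff.trans (by rw [sub_neg_eq_add])
  rw [mem_gjoins]
  refine ⟨(hVχ _).2 (by rw [sub_add_cancel]; exact ⟨_, hlo, Sym2.mem_mk_left _ _⟩), ?_⟩
  unfold IsGlobalJoin
  refine ⟨?_, trE (-v) T, trE (-v) S, isPolygon_translate _ hT, isPolygon_translate _ hS, fun x h1 h2 => ?_,
    ?_, ?_, ?_⟩
  · -- the plaquette translates
    rw [hχe, sub_eq_add_neg]
    exact isJoinPlaq_translate hplaq
  · -- vertex-disjointness translates
    change IsV (trE (-v) T) x at h1
    change IsV (trE (-v) S) x at h2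
    rw [isV_translate_iff] at h1 h2
    exact hdisj _ h1 h2
  · -- the flip translates
    rw [hχe, ← translate_union, ← hflip, sub_eq_add_neg, flipH_translate]
  · -- the root lies on the `T`-side: `v ∈ V(T)` since `S` is above row `0` and `e₀ ∈ V(T)`
    change IsV (trE (-v) T) 0
    rw [isV_translate_iff, zero_sub, neg_neg]
    rcases (hVJ v).1 hvJ with h | h
    · exact h
    · exfalso
      have h1 := hSrow v h
      rcases hvmin' e₀ ((hVJ e₀).2 (Or.inl he₀T)) with h2 | ⟨h2, -⟩
      · rw [e₀_e₁_apply.2.1] at h2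
        omega
      · rw [e₀_e₁_apply.2.1] at h2
        omega
  · -- every rightmost vertex lies on the `S`-side
    intro x hx
    rw [mem_rightCol] at hx
    obtain ⟨hxv, hx0⟩ := hx
    change IsV (trE (-v) S) x
    rw [isV_translate_iff, sub_neg_eq_add]
    rcases (hVJ _).1 ((hVχ x).1 hxv) with h | h
    · exfalso
      have h1 := hwT _ h
      have hwv : w - v ∈ verts n χ := (hVχ _).2 (by rw [sub_add_cancel]; exact (hVJ w).2 (Or.inr hwS))
      have h2 := (bounds_of_mem_verts hwv).2.1
      rw [← hx0] at h2
      simp only [Pi.add_apply, Pi.sub_apply] at h1 h2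
      omega
    · exact h

/-- **Stub `joinPoly_reroot`.** Re-rooting the Madras join `J = joinPoly j m χ₁ χ₂ k` of two admissible
lex-rooted classes at its lowest-then-leftmost vertex `v` gives a lex-rooted class of walk length
`j + m + 17` whose rooted polygon is `J - v`, and the translated junction corner is a GLOBAL join
plaquette of it (root on the `τ̃`-side, all rightmost vertices on the `σ̂`-side).
[cite: Hammond2015SAPJoining, Definition 4.4] -/
theorem joinPoly_reroot : ∀ (j m : ℕ) (χ₁ χ₂ : ℕ → Site 2) (k : ℤ), χ₁ ∈ lexRooted j → χ₂ ∈ lexRooted m → 3 ≤ j → 3 ≤ m → k ∈ offsets j m χ₁ χ₂ →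
    rerootWalk (joinPoly j m χ₁ χ₂ k) (j + m + 17) ∈ lexRooted (j + m + 17) ∧
    pedges (j + m + 17) (rerootWalk (joinPoly j m χ₁ χ₂ k) (j + m + 17)) = trE (-lexMinV (vxs (joinPoly j m χ₁ χ₂ k))) (joinPoly j m χ₁ χ₂ k) ∧
    rerootSite (joinPoly j m χ₁ χ₂ k) (joinCorner j m χ₁ χ₂ k) ∈ gjoins (j + m + 17) (rerootWalk (joinPoly j m χ₁ χ₂ k) (j + m + 17)) := by
  intro j m χ₁ χ₂ k h₁ h₂ hj hm hk
  obtain ⟨hJ, hJc, hplaq, hT, hS, hdisj, hflip, hSrow, he₀T, hw, -, -⟩ :=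
    joinPoly_spec j m χ₁ χ₂ k h₁ h₂ hj hm hk
  exact reroot_of_split hJ hJc hplaq hT hS hdisj hflip hSrow he₀T hw

end Summit.CriticalPhenomena.SAWScalingLimit.Theorems.CriticalBubbleBound.Join

end
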